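import Summits.AtomisticToContinuum.FouriersLaw.Theorems.LatticeLandauDampingAbelThermodynamicLimitEqualTimeBound
import Summits.AtomisticToContinuum.FouriersLaw.Theorems.LatticeLandauDampingAbelThermodynamicLimitAutocorrIntegrableOn
import Summits.AtomisticToContinuum.FouriersLaw.Theorems.EmbeddedDrudeMourreAbelThermodynamicLimitOfLowerBound
import Summits.AtomisticToContinuum.FouriersLaw.Theses.LatticeLandauDamping
import HarnessLib

/-!
# The BIRTH CUT of (R) `UniformAbelianRegularity`, importable: line `series-law-at-every-laplace-frequency`
(SketchIdeator2), rev 12 — crux `LatticeLandauDamping.AbelThermodynamicLimit` (stmt-AtomisticToContinuum-14013,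
`Iff.rfl`-identical to `EmbeddedDrudeMourre.AbelThermodynamicLimit`, stmt-AtomisticToContinuum-12596);
`--supports` glue file, closes nothing

The crux is reduced (landed certificate `LoomisCompactHorizonWitness.stub_cruxOfRegularityOfLowerBound`,
p127832) to the two items (R) = `StaticAbelianSqueeze.UniformAbelianRegularity` (stmt-AtomisticToContinuum-13416) and
CLB = `StaticAbelianSqueeze.ConductanceLowerBound` (stmt-AtomisticToContinuum-11749).  The registered skeleton of (R)
itself (`Cruxes/UniformAbelianRegularity/Lines/birth.lean`, planner-skel-stmt-AtomisticToContinuum-13416-0, 2026-08-17)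
cuts (R) at an `N`-INDEPENDENT time horizon `τ`: with `c_N(t) = ∫ J·(P_t J) dμ_{N,T}` the equilibrium
autocorrelation of the total bond current `J = Σ_i j_i` of the OPEN `N`-chain (`gibbsMeasure N T`, constructed
kernels `transitionKernel N T T t`),

  `|∫₀^∞ (1 − e^{−νt}) c_N(t) dt| ≤ ν τ² · sup_t |c_N(t)| + ∫_τ^∞ |c_N(t)| dt`   (`abel_deficit_le`),

so (R) follows from an EARLY bound `|c_N(t)| ≤ C·N` (birth stub 1 `stub_equalTimeBound`) and a LATE `N`-uniform
`L¹` tail `c_N ∈ L¹(0,∞)`, `∫_τ^∞|c_N| ≤ εN` (birth stub 2 `stub_uniformL1Tail`).  A `Cruxes/` module is not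
importable, and the same cut is copied a second time in the twin's `Lines/l1_tail_transport.lean`; this file makes
it a citable theorem ONCE, for the three chains (13416, 12596, 14013), and plugs in what this line has LANDED:

* `abel_deficit_le` — the abstract real-analysis estimate (verbatim from birth.lean; folklore);
* `uniformAbelianRegularity_of_equalTimeBound_of_uniformL1Tail` — birth's composition `stub₁ → stub₂ → (R)` BY NAME
  (verbatim statement and proof of birth's `UniformAbelianRegularity_of`);
* `uniformL1Tail_of_uniformAbsTail` — birth stub 2 from its `N`-uniform ABSOLUTE-TAIL conjunct alone, the fixed-`N`
  integrability conjunct being the LANDED `stub_autocorrIntegrableOn` (p144688, every `N`);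
* `stub_uniformAbelianRegularityOfUniformAbsTail` (registered glue stub) — **(R) BY NAME from ONE typed residual**,
  the `N`-uniform absolute tail `∀ ε ∃ τ ∃ N₀ ∀ N ≥ N₀, ∫_{(τ,∞)}|c_N| ≤ εN`, since birth stub 1 is the LANDED
  `stub_equalTimeBound` (p144650, from `pinnedChain_abs_totalCurrentAutocorr_le_linear`: `⟨J,P_tJ⟩ ≤ ‖J‖² ≤ 3MN`);
* `stub_cruxOfUniformAbsTailOfLowerBound` (registered glue stub) — the crux BY NAME from that residual and CLB
  (through p127832; the twin decl by `Iff.rfl`, `twinCrux_of_uniformAbsTail_of_lowerBound`);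
* `stub_latticeCruxOfRegularityOfLowerBound` (registered glue stub) — the item-level split (R) → CLB → crux for THIS decl
  (p127832 transported along the definitional equality of the twin decls; the future closing one-liner of the item).

What is NOT here: the residual itself (`stub_uniformAbsTail`, lead-held, open-problem class: sharp
`HasBoundedResponse` in time-domain form — Bonetto–Lebowitz–Rey-Bellet 2000 §6.3/§7; false at the harmonic corner)
and CLB (led in its own chain).  No named fact is used; nothing here closes an item.
References: Bonetto–Lebowitz–Rey-Bellet 2000 §7; Kundu–Dhar–Narayan 2009; Cuneo–Eckmann–Hairer–Rey-Bellet 2018.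
-/

noncomputable section

open MeasureTheory ProbabilityTheory Filter Topology Set Function
open scoped NNReal ENNReal

namespace Summit.AtomisticToContinuum.FouriersLaw.Theorems.AbelThermodynamicLimit.SeriesLawAtEveryLaplaceFrequency

open Literature.MathematicalPhysics.KineticTheory.HeatConduction

/-! ## §1 The Abel-deficit estimate (abstract real analysis) -/

/-- **The Abel-deficit estimate, abstract form.** If `c ∈ L¹(0,∞)`, `|c| ≤ C` on `(0,∞)` and `∫_{(τ,∞)} |c| ≤ B`, then for
`ν, τ > 0`: `|∫_{(0,∞)} (1 − e^{−νt}) c(t) dt| ≤ ν τ² C + B` — split at `τ`, use `0 ≤ 1 − e^{−νt} ≤ min(νt, 1)`. [folklore] -/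
theorem abel_deficit_le {c : ℝ → ℝ} {ν τ C B : ℝ} (hν : 0 < ν) (hτ : 0 < τ) (hC : 0 ≤ C)
    (hint : IntegrableOn c (Ioi 0))
    (hbound : ∀ t : ℝ, 0 < t → |c t| ≤ C)
    (htail : (∫ t in Ioi τ, |c t|) ≤ B) :
    |∫ t in Ioi (0:ℝ), (1 - Real.exp (-(ν * t))) * c t| ≤ ν * τ ^ 2 * C + B := by
  -- the weight `w(t) = 1 - e^{-νt}`: `0 ≤ w ≤ 1` and `w(t) ≤ νt` on `(0, ∞)`
  have hw0 : ∀ t : ℝ, 0 < t → 0 ≤ 1 - Real.exp (-(ν * t)) := fun t ht => by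
    have h : Real.exp (-(ν * t)) ≤ 1 :=
      Real.exp_le_one_iff.2 (by nlinarith [mul_pos hν ht])
    linarith
  have hw1 : ∀ t : ℝ, 0 < t → 1 - Real.exp (-(ν * t)) ≤ 1 := fun t _ => by
    linarith [Real.exp_pos (-(ν * t))]
  have hwlin : ∀ t : ℝ, 0 < t → 1 - Real.exp (-(ν * t)) ≤ ν * t := fun t _ => by
    linarith [Real.add_one_le_exp (-(ν * t))]
  -- integrability of the weighted autocorrelation on `(0, ∞)`
  have hcont : Continuous fun t : ℝ => 1 - Real.exp (-(ν * t)) := by fun_prop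
  have hf_int : IntegrableOn (fun t : ℝ => (1 - Real.exp (-(ν * t))) * c t) (Ioi 0) := by
    refine Integrable.mono hint (hcont.aestronglyMeasurable.mul hint.aestronglyMeasurable) ?_
    refine (ae_restrict_iff' measurableSet_Ioi).2 (Filter.Eventually.of_forall fun t ht => ?_)
    rw [norm_mul, Real.norm_eq_abs, abs_of_nonneg (hw0 t ht)]
    exact mul_le_of_le_one_left (norm_nonneg _) (hw1 t ht)
  -- split `(0, ∞) = (0, τ] ∪ (τ, ∞)`
  have hsplit : ∫ t in Ioi (0:ℝ), (1 - Real.exp (-(ν * t))) * c t =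
      (∫ t in Ioc (0:ℝ) τ, (1 - Real.exp (-(ν * t))) * c t) +
        ∫ t in Ioi τ, (1 - Real.exp (-(ν * t))) * c t := by
    rw [← Ioc_union_Ioi_eq_Ioi hτ.le]
    exact setIntegral_union (Ioc_disjoint_Ioi le_rfl) measurableSet_Ioi
      (hf_int.mono_set Ioc_subset_Ioi_self) (hf_int.mono_set (Ioi_subset_Ioi hτ.le))
  -- EARLY piece: `‖∫_{(0,τ]} w c‖ ≤ (ν τ C) · |(0, τ]| = ν τ² C`
  have hearly : ‖∫ t in Ioc (0:ℝ) τ, (1 - Real.exp (-(ν * t))) * c t‖ ≤ ν * τ * C * τ := by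
    have h := norm_setIntegral_le_of_norm_le_const (μ := (volume : Measure ℝ)) (s := Ioc (0:ℝ) τ)
      (f := fun t : ℝ => (1 - Real.exp (-(ν * t))) * c t) (C := ν * τ * C) measure_Ioc_lt_top
      (fun t ht => by
        rw [Real.norm_eq_abs, abs_mul, abs_of_nonneg (hw0 t ht.1)]
        calc (1 - Real.exp (-(ν * t))) * |c t| ≤ (ν * t) * C :=
              mul_le_mul (hwlin t ht.1) (hbound t ht.1) (abs_nonneg _) (by nlinarith [ht.1])
          _ ≤ ν * τ * C := mul_le_mul_of_nonneg_right (mul_le_mul_of_nonneg_left ht.2 hν.le) hC)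
    rwa [Real.volume_real_Ioc_of_le hτ.le, sub_zero] at h
  -- LATE piece: `‖∫_{(τ,∞)} w c‖ ≤ ∫_{(τ,∞)} |c| ≤ B`
  have hlate : ‖∫ t in Ioi τ, (1 - Real.exp (-(ν * t))) * c t‖ ≤ B := by
    calc ‖∫ t in Ioi τ, (1 - Real.exp (-(ν * t))) * c t‖
          ≤ ∫ t in Ioi τ, ‖(1 - Real.exp (-(ν * t))) * c t‖ := norm_integral_le_integral_norm _
      _ ≤ ∫ t in Ioi τ, |c t| := by
          refine setIntegral_mono_on (hf_int.mono_set (Ioi_subset_Ioi hτ.le)).norm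
            (hint.mono_set (Ioi_subset_Ioi hτ.le)).abs measurableSet_Ioi fun t ht => ?_
          have ht0 : 0 < t := lt_trans hτ ht
          rw [norm_mul, Real.norm_eq_abs, Real.norm_eq_abs, abs_of_nonneg (hw0 t ht0)]
          exact mul_le_of_le_one_left (abs_nonneg _) (hw1 t ht0)
      _ ≤ B := htail
  -- assemble
  rw [← Real.norm_eq_abs, hsplit]
  calc ‖(∫ t in Ioc (0:ℝ) τ, (1 - Real.exp (-(ν * t))) * c t) + ∫ t in Ioi τ, (1 - Real.exp (-(ν * t))) * c t‖
        ≤ ‖∫ t in Ioc (0:ℝ) τ, (1 - Real.exp (-(ν * t))) * c t‖ + ‖∫ t in Ioi τ, (1 - Real.exp (-(ν * t))) * c t‖ :=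
          norm_add_le _ _
    _ ≤ ν * τ * C * τ + B := add_le_add hearly hlate
    _ = ν * τ ^ 2 * C + B := by ring

/-! ## §2 Birth's composition: EARLY bound → LATE `L¹` tail → (R) by name -/

/-- **Birth's composition, importable** (statement and proof verbatim `UniformAbelianRegularity_of` of
`Cruxes/UniformAbelianRegularity/Lines/birth.lean`): the `stub_equalTimeBound`-statement and the
`stub_uniformL1Tail`-statement imply `StaticAbelianSqueeze.UniformAbelianRegularity` BY NAME.  Given `ε`: `τ, N₂`
from the tail at `ε/2`, `C, N₁` from the early bound, `C' = max C 1`, `ν₀ = ε/(2(C'τ²+1))`; for `0 < ν < ν₀` and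
`N ≥ max N₁ N₂`, `abel_deficit_le` gives `|∫₀^∞(1−e^{−νt})c_N| ≤ ντ²C'N + εN/2 ≤ εN`. [folklore] -/
theorem uniformAbelianRegularity_of_equalTimeBound_of_uniformL1Tail :
    (∀ ω₂ lam β γ : ℝ, 0 < ω₂ → 0 < lam → 0 < β → 0 < γ → ∀ T : ℝ, 0 < T → ∃ C : ℝ, ∃ N₀ : ℕ, ∀ N : ℕ, N₀ ≤ N → ∀ t : ℝ, 0 < t → let J : Literature.MathematicalPhysics.KineticTheory.HeatConduction.PhaseSpace N → ℝ := fun z => ∑ i : Fin N, (Literature.MathematicalPhysics.KineticTheory.HeatConduction.pinnedChain ω₂ lam β γ).bondCurrent N i z; |∫ z, J z * (∫ y, J y ∂((Literature.MathematicalPhysics.KineticTheory.HeatConduction.pinnedChain ω₂ lam β γ).transitionKernel N T T t.toNNReal z)) ∂((Literature.MathematicalPhysics.KineticTheory.HeatConduction.pinnedChain ω₂ lam β γ).gibbsMeasure N T)| ≤ C * N) →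
    (∀ ω₂ lam β γ : ℝ, 0 < ω₂ → 0 < lam → 0 < β → 0 < γ → ∀ T : ℝ, 0 < T → ∀ ε : ℝ, 0 < ε → ∃ τ : ℝ, 0 < τ ∧ ∃ N₀ : ℕ, ∀ N : ℕ, N₀ ≤ N → let J : Literature.MathematicalPhysics.KineticTheory.HeatConduction.PhaseSpace N → ℝ := fun z => ∑ i : Fin N, (Literature.MathematicalPhysics.KineticTheory.HeatConduction.pinnedChain ω₂ lam β γ).bondCurrent N i z; MeasureTheory.IntegrableOn (fun t : ℝ => ∫ z, J z * (∫ y, J y ∂((Literature.MathematicalPhysics.KineticTheory.HeatConduction.pinnedChain ω₂ lam β γ).transitionKernel N T T t.toNNReal z)) ∂((Literature.MathematicalPhysics.KineticTheory.HeatConduction.pinnedChain ω₂ lam β γ).gibbsMeasure N T)) (Set.Ioi 0) ∧ (∫ t in Set.Ioi τ, |∫ z, J z * (∫ y, J y ∂((Literature.MathematicalPhysics.KineticTheory.HeatConduction.pinnedChain ω₂ lam β γ).transitionKernel N T T t.toNNReal z)) ∂((Literature.MathematicalPhysics.KineticTheory.HeatConduction.pinnedChain ω₂ lam β γ).gibbsMeasure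 N T)|) ≤ ε * N) →
    Summit.AtomisticToContinuum.FouriersLaw.Theses.StaticAbelianSqueeze.UniformAbelianRegularity := by
  intro h1 h2 ω₂ lam β γ hω hl hβ hγ T hT ε hε
  obtain ⟨C, N₁, hC⟩ := h1 ω₂ lam β γ hω hl hβ hγ T hT
  obtain ⟨τ, hτ, N₂, hL⟩ := h2 ω₂ lam β γ hω hl hβ hγ T hT (ε / 2) (half_pos hε)
  have hC' : 0 < max C 1 := lt_of_lt_of_le one_pos (le_max_right _ _)
  have hden : 0 < 2 * (max C 1 * τ ^ 2 + 1) := by positivity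
  refine ⟨ε / (2 * (max C 1 * τ ^ 2 + 1)), div_pos hε hden, fun ν hν hνlt => ⟨max N₁ N₂, fun N hN => ?_⟩⟩
  have hN1 : N₁ ≤ N := le_trans (le_max_left _ _) hN
  have hN2 : N₂ ≤ N := le_trans (le_max_right _ _) hN
  have hN0 : (0:ℝ) ≤ N := Nat.cast_nonneg N
  intro J
  have hint : MeasureTheory.IntegrableOn (fun t : ℝ => ∫ z, J z * (∫ y, J y ∂((Literature.MathematicalPhysics.KineticTheory.HeatConduction.pinnedChain ω₂ lam β γ).transitionKernel N T T t.toNNReal z)) ∂((Literature.MathematicalPhysics.KineticTheory.HeatConduction.pinnedChain ω₂ lam β γ).gibbsMeasure N T)) (Set.Ioi 0) := (hL N hN2).1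
  have htail : (∫ t in Set.Ioi τ, |∫ z, J z * (∫ y, J y ∂((Literature.MathematicalPhysics.KineticTheory.HeatConduction.pinnedChain ω₂ lam β γ).transitionKernel N T T t.toNNReal z)) ∂((Literature.MathematicalPhysics.KineticTheory.HeatConduction.pinnedChain ω₂ lam β γ).gibbsMeasure N T)|) ≤ ε / 2 * N := (hL N hN2).2
  have hbound : ∀ t : ℝ, 0 < t → |∫ z, J z * (∫ y, J y ∂((Literature.MathematicalPhysics.KineticTheory.HeatConduction.pinnedChain ω₂ lam β γ).transitionKernel N T T t.toNNReal z)) ∂((Literature.MathematicalPhysics.KineticTheory.HeatConduction.pinnedChain ω₂ lam β γ).gibbsMeasure N T)| ≤ max C 1 * N := fun t ht =>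
    le_trans (hC N hN1 t ht) (mul_le_mul_of_nonneg_right (le_max_left _ _) hN0)
  have key := abel_deficit_le (c := fun t : ℝ => ∫ z, J z * (∫ y, J y ∂((Literature.MathematicalPhysics.KineticTheory.HeatConduction.pinnedChain ω₂ lam β γ).transitionKernel N T T t.toNNReal z)) ∂((Literature.MathematicalPhysics.KineticTheory.HeatConduction.pinnedChain ω₂ lam β γ).gibbsMeasure N T)) hν hτ (mul_nonneg hC'.le hN0) hint hbound htail
  refine le_trans key ?_
  -- arithmetic: `ν τ² C' N + ε N / 2 ≤ ε N` because `ν (C' τ² + 1) < ε / 2`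
  have hν2 : ν * (2 * (max C 1 * τ ^ 2 + 1)) < ε := (lt_div_iff₀ hden).1 hνlt
  have h4 : ν * τ ^ 2 * max C 1 ≤ ε / 2 := by nlinarith [hν.le]
  have h5 : ν * τ ^ 2 * (max C 1 * (N : ℝ)) ≤ ε / 2 * N := by
    calc ν * τ ^ 2 * (max C 1 * (N : ℝ)) = (ν * τ ^ 2 * max C 1) * N := by ring
      _ ≤ ε / 2 * N := mul_le_mul_of_nonneg_right h4 hN0
  linarith

/-! ## §3 Plugging in the landed stubs: (R) and the crux from ONE typed residual -/

/-- **Birth stub 2 from its absolute-tail conjunct**: the `N`-uniform absolute tail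
`∀ ε ∃ τ ∃ N₀ ∀ N ≥ N₀, ∫_{(τ,∞)}|c_N| ≤ εN` implies the `stub_uniformL1Tail`-statement, the fixed-`N` conjunct
`c_N ∈ L¹(0,∞)` being the landed `stub_autocorrIntegrableOn` (every `N`). [folklore] -/
theorem uniformL1Tail_of_uniformAbsTail :
    (∀ ω₂ lam β γ : ℝ, 0 < ω₂ → 0 < lam → 0 < β → 0 < γ → ∀ T : ℝ, 0 < T → ∀ ε : ℝ, 0 < ε → ∃ τ : ℝ, 0 < τ ∧ ∃ N₀ : ℕ, ∀ N : ℕ, N₀ ≤ N → let J : Literature.MathematicalPhysics.KineticTheory.HeatConduction.PhaseSpace N → ℝ := fun z => ∑ i : Fin N, (Literature.MathematicalPhysics.KineticTheory.HeatConduction.pinnedChain ω₂ lam β γ).bondCurrent N i z; (∫ t in Set.Ioi τ, |∫ z, J z * (∫ y, J y ∂((Literature.MathematicalPhysics.KineticTheory.HeatConduction.pinnedChain ω₂ lam β γ).transitionKernel N T T t.toNNReal z)) ∂((Literature.MathematicalPhysics.KineticTheory.HeatConduction.pinnedChain ω₂ lam β γ).gibbsMeasure N T)|) ≤ ε * N)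 →
    (∀ ω₂ lam β γ : ℝ, 0 < ω₂ → 0 < lam → 0 < β → 0 < γ → ∀ T : ℝ, 0 < T → ∀ ε : ℝ, 0 < ε → ∃ τ : ℝ, 0 < τ ∧ ∃ N₀ : ℕ, ∀ N : ℕ, N₀ ≤ N → let J : Literature.MathematicalPhysics.KineticTheory.HeatConduction.PhaseSpace N → ℝ := fun z => ∑ i : Fin N, (Literature.MathematicalPhysics.KineticTheory.HeatConduction.pinnedChain ω₂ lam β γ).bondCurrent N i z; MeasureTheory.IntegrableOn (fun t : ℝ => ∫ z, J z * (∫ y, J y ∂((Literature.MathematicalPhysics.KineticTheory.HeatConduction.pinnedChain ω₂ lam β γ).transitionKernel N T T t.toNNReal z)) ∂((Literature.MathematicalPhysics.KineticTheory.HeatConduction.pinnedChain ω₂ lam β γ).gibbsMeasure N T)) (Set.Ioi 0) ∧ (∫ t in Set.Ioi τ, |∫ z, J z * (∫ y, J y ∂((Literature.MathematicalPhysics.KineticTheory.HeatConduction.pinnedChain ω₂ lam β γ).transitionKernel N T T t.toNNReal z)) ∂((Literature.MathematicalPhysics.KineticTheory.HeatConduction.pinnedChain ω₂ lam β γ).gibbsMeasure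 N T)|) ≤ ε * N) := by
  intro h ω₂ lam β γ hω hl hβ hγ T hT ε hε
  obtain ⟨τ, hτ, N₀, hN₀⟩ := h ω₂ lam β γ hω hl hβ hγ T hT ε hε
  exact ⟨τ, hτ, N₀, fun N hN => ⟨stub_autocorrIntegrableOn ω₂ lam β γ hω hl hβ hγ T hT N, hN₀ N hN⟩⟩

/-- **Registered glue stub `stub_uniformAbelianRegularityOfUniformAbsTail` — (R) BY NAME from ONE typed residual.**
For `P = pinnedChain ω₂ lam β γ` (all `> 0`), `T > 0`: IF for every `ε > 0` there are `τ > 0` and `N₀` with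
`∫_{(τ,∞)} |c_N(t)| dt ≤ ε·N` for all `N ≥ N₀` (the `N`-uniform absolute tail of the open chain's total-current
autocorrelation per unit length), THEN `StaticAbelianSqueeze.UniformAbelianRegularity` (item stmt-AtomisticToContinuum-13416).
Proof: birth's composition with the landed `stub_equalTimeBound` (early bound) and `uniformL1Tail_of_uniformAbsTail`.
[cite: BonettoLebowitzReyBellet2000, §7 eq. (35)] -/
theorem stub_uniformAbelianRegularityOfUniformAbsTail :
    (∀ ω₂ lam β γ : ℝ, 0 < ω₂ → 0 < lam → 0 < β → 0 < γ → ∀ T : ℝ, 0 < T → ∀ ε : ℝ, 0 < ε → ∃ τ : ℝ, 0 < τ ∧ ∃ N₀ : ℕ, ∀ N : ℕ, N₀ ≤ N → let J : Literature.MathematicalPhysics.KineticTheory.HeatConduction.PhaseSpace N → ℝ := fun z => ∑ i : Fin N, (Literature.MathematicalPhysics.KineticTheory.HeatConduction.pinnedChain ω₂ lam β γ).bondCurrent N i z; (∫ t in Set.Ioi τ, |∫ z, J z * (∫ y, J y ∂((Literature.MathematicalPhysics.KineticTheory.HeatConduction.pinnedChain ω₂ lam β γ).transitionKernel N T T t.toNNReal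 z)) ∂((Literature.MathematicalPhysics.KineticTheory.HeatConduction.pinnedChain ω₂ lam β γ).gibbsMeasure N T)|) ≤ ε * N) → Summit.AtomisticToContinuum.FouriersLaw.Theses.StaticAbelianSqueeze.UniformAbelianRegularity :=
  fun h => uniformAbelianRegularity_of_equalTimeBound_of_uniformL1Tail stub_equalTimeBound
    (uniformL1Tail_of_uniformAbsTail h)

/-- **Registered glue stub `stub_cruxOfUniformAbsTailOfLowerBound` — the crux BY NAME from the residual and CLB.**
The `N`-uniform absolute tail (above) and `StaticAbelianSqueeze.ConductanceLowerBound` (item stmt-AtomisticToContinuum-11749)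
imply `LatticeLandauDamping.AbelThermodynamicLimit`: (R) from the tail (`stub_uniformAbelianRegularityOfUniformAbsTail`),
then the twin's landed certificate `LoomisCompactHorizonWitness.stub_cruxOfRegularityOfLowerBound` (p127832: (R) → CLB →
crux; the hypothesis witness is not used) — the two crux decls are `Iff.rfl`-identical.
[cite: BonettoLebowitzReyBellet2000, §7 eq. (37)] [cite: KunduDharNarayan2009, eqs. (8)–(15)] -/
theorem stub_cruxOfUniformAbsTailOfLowerBound :
    (∀ ω₂ lam β γ : ℝ, 0 < ω₂ → 0 < lam → 0 < β → 0 < γ → ∀ T : ℝ, 0 < T → ∀ ε : ℝ, 0 < ε → ∃ τ : ℝ, 0 < τ ∧ ∃ N₀ : ℕ, ∀ N : ℕ, N₀ ≤ N → let J : Literature.MathematicalPhysics.KineticTheory.HeatConduction.PhaseSpace N → ℝ := fun z => ∑ i : Fin N, (Literature.MathematicalPhysics.KineticTheory.HeatConduction.pinnedChain ω₂ lam β γ).bondCurrent N i z; (∫ t in Set.Ioi τ, |∫ z, J z * (∫ y, J y ∂((Literature.MathematicalPhysics.KineticTheory.HeatConduction.pinnedChain ω₂ lam β γ).transitionKernel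 N T T t.toNNReal z)) ∂((Literature.MathematicalPhysics.KineticTheory.HeatConduction.pinnedChain ω₂ lam β γ).gibbsMeasure N T)|) ≤ ε * N) → Summit.AtomisticToContinuum.FouriersLaw.Theses.StaticAbelianSqueeze.ConductanceLowerBound → Summit.AtomisticToContinuum.FouriersLaw.Theses.LatticeLandauDamping.AbelThermodynamicLimit :=
  fun h hCLB =>
    Summit.AtomisticToContinuum.FouriersLaw.Theorems.AbelThermodynamicLimit.LoomisCompactHorizonWitness.stub_cruxOfRegularityOfLowerBound
      (stub_uniformAbelianRegularityOfUniformAbsTail h) hCLB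

/-- The same composition for the `Iff.rfl`-identical twin crux `EmbeddedDrudeMourre.AbelThermodynamicLimit`
(stmt-AtomisticToContinuum-12596, whose line `l1_tail_transport` registers the same birth stubs). [folklore] -/
theorem twinCrux_of_uniformAbsTail_of_lowerBound :
    (∀ ω₂ lam β γ : ℝ, 0 < ω₂ → 0 < lam → 0 < β → 0 < γ → ∀ T : ℝ, 0 < T → ∀ ε : ℝ, 0 < ε → ∃ τ : ℝ, 0 < τ ∧ ∃ N₀ : ℕ, ∀ N : ℕ, N₀ ≤ N → let J : Literature.MathematicalPhysics.KineticTheory.HeatConduction.PhaseSpace N → ℝ := fun z => ∑ i : Fin N, (Literature.MathematicalPhysics.KineticTheory.HeatConduction.pinnedChain ω₂ lam β γ).bondCurrent N i z; (∫ t in Set.Ioi τ, |∫ z, J z * (∫ y, J y ∂((Literature.MathematicalPhysics.KineticTheory.HeatConduction.pinnedChain ω₂ lam β γ).transitionKernel N T T t.toNNReal z)) ∂((Literature.MathematicalPhysics.KineticTheory.HeatConduction.pinnedChain ω₂ lam β γ).gibbsMeasure N T)|) ≤ ε * N) → Summit.AtomisticToContinuum.FouriersLaw.Theses.StaticAbelianSqueeze.ConductanceLowerBound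 →
    Summit.AtomisticToContinuum.FouriersLaw.Theses.EmbeddedDrudeMourre.AbelThermodynamicLimit :=
  fun h hCLB =>
    Summit.AtomisticToContinuum.FouriersLaw.Theorems.AbelThermodynamicLimit.LoomisCompactHorizonWitness.stub_cruxOfRegularityOfLowerBound
      (stub_uniformAbelianRegularityOfUniformAbsTail h) hCLB

/-! ## §4 The item-level split for THIS crux decl: (R) → CLB → `LatticeLandauDamping.AbelThermodynamicLimit` -/

/-- **Registered glue stub `stub_latticeCruxOfRegularityOfLowerBound` — the {(R), CLB} split of the crux, for the
`LatticeLandauDamping` decl BY NAME**: `StaticAbelianSqueeze.UniformAbelianRegularity → StaticAbelianSqueeze.ConductanceLowerBound →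
LatticeLandauDamping.AbelThermodynamicLimit`.  It is the twin's landed certificate
`LoomisCompactHorizonWitness.stub_cruxOfRegularityOfLowerBound` (p127832, concluding the `EmbeddedDrudeMourre` decl) transported
along the definitional equality of the two crux decls; the closing file of this item, once stmt-13416 and stmt-11749 are proved, is
the one-liner `stub_latticeCruxOfRegularityOfLowerBound UniformAbelianRegularity_holds ConductanceLowerBound_holds`.
[cite: BonettoLebowitzReyBellet2000, §7 eq. (37)] -/
theorem stub_latticeCruxOfRegularityOfLowerBound :
    Summit.AtomisticToContinuum.FouriersLaw.Theses.StaticAbelianSqueeze.UniformAbelianRegularity → Summit.AtomisticToContinuum.FouriersLaw.Theses.StaticAbelianSqueeze.ConductanceLowerBound → Summit.AtomisticToContinuum.FouriersLaw.Theses.LatticeLandauDamping.AbelThermodynamicLimit :=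
  fun hR hCLB =>
    Summit.AtomisticToContinuum.FouriersLaw.Theorems.AbelThermodynamicLimit.LoomisCompactHorizonWitness.stub_cruxOfRegularityOfLowerBound
      hR hCLB

end Summit.AtomisticToContinuum.FouriersLaw.Theorems.AbelThermodynamicLimit.SeriesLawAtEveryLaplaceFrequency

end
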